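import Literature.NumberTheory.ComplexMultiplication.EllipticUnits.ImaginaryQuadraticMainConjectureCarriersOLevels
import Literature.NumberTheory.GaloisRepresentations.RelativeCorestrictionNaturality
import Literature.Algebra.Module.LocallyNilpotentPowerSeriesModule
import HarnessLib

/-!
# EXISTENCE of the pinned `𝒪`-coefficient carriers
# `H^i(𝒪_K[1/p𝔣], Λ_𝒪(χ)(1)) = lim←_{n,k} H^i(G_S(K̃_n), 𝒪 ⊗ μ_{p^k} ⊗ θ)` (`i = 0, 1, 2`) of Johnson-Leung–Kings 2011
# Def. 4.2 (94) / Cor. 5.3 with their `Λ_𝒪 = 𝒪⟦Gal(K_∞/K)⟧`-structure — part II: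
# `Nonempty (JohnsonLeungKings2011.IwasawaCohomologyDataO S κ₁ κ₂ γ₁ γ₂ θ 𝔣 i)` for EVERY number field, prime,
# coefficient set, pair of `ℤ_p`-extensions, pair of group elements, character and modulus

Topic `Literature/NumberTheory/ComplexMultiplication/EllipticUnits` (grouping sub-namespace `JohnsonLeungKings2011`);
part II of the construction asked for by the review of `ImaginaryQuadraticMainConjectureCarriersO.lean` (p776397: «a
construction item should follow as for the ℤ_p twin») — part I: `ImaginaryQuadraticMainConjectureCarriersOLevels.lean`;
the `ℤ_p` twin: `ImaginaryQuadraticMainConjectureCarriersExist.lean` (cf2-p1-w5, F0a). INPUTS hand `bsd-inputs-honda-p1`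
g22 (crux L `SmallImageLowerHalfBothSigns`, line `rtt_w3`, row D2-O-exist). Transparent definitions (the ambient
coefficient morphism `coeffMapHomO`, three `letI`-recipes of module structures — choices from
`LocallyNilpotent.exists_module_powerSeries₂`, whose ACTION is forced —, the submodule `compatibleFamiliesO`, the datum
`iwasawaCohomologyDataO`) and theorems; no named fact, no `instance`, no `sorry`.

THE CONSTRUCTION (Kato §8.2, JLK Def. 4.1 "`Λ_𝒪 := Λ ⊗̂_{ℤ_p} 𝒪_p`" / Def. 4.2 (94), Lang Ch. 5 §1): `H :=` the
`Λ_𝒪`-submodule `compatibleFamiliesO` of `∏_{n,k} H^i(G_S(K̃_n), 𝒪 ⊗ μ_{p^k} ⊗ θ)` (compatible with `layerCoresO`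
and `layerRedO`) for the LEVELWISE `Λ_𝒪 = 𝒪⟦T₂⟧⟦T₁⟧`-structures `T_i ↦ ψ_{γ_i} = conj_{γ_i} − 1`, `c ↦ H^i(c ⊗ id)`
(`layerModuleO₂`, from the tree's `LocallyNilpotent.exists_module_powerSeries₂` on part I's commuting locally nilpotent
`𝒪`-linear `layerPsiO`), stable because the transitions are `Λ_𝒪`-LINEAR (`LocallyNilpotent.map_smul₂_of_comp_eq`: they
are `𝒪`-linear — the corestrictions by the all-degree naturality `relCor_cohomologyMap`
(`RelativeCorestrictionNaturality.lean`), the reductions by part I — and intertwine the conjugations — `relCor_conjMap`,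
part I); `proj n k :=` the coordinates; (P1)–(P8) are then unfoldings (`layerModuleO_spec`, `C_X_smul`, `C_C_smul`).
NO hypothesis on `K`, `(γ₁, γ₂)`, `S`, `θ`, `𝔣`: **`iwasawaCohomologyDataOExists`**.

* §1 `coeffMapHomO`, `map_levelMapHomO_eq_cohomologyMap` (rfl bridge to the tree's `cohomologyMap`),
  `layerCoresO_layerConjO`, `layerCoresO_layerScalarO`.
* §2 `exists_layerModuleO`, `layerModuleO₁`, `layerModuleO₂`, `layerModuleO_spec`, `layerCoresO_smul`, `layerRedO_smul`.
* §3 `piLayerModuleO` (+ `_smul_apply`), `compatibleFamiliesO`, `iwasawaCohomologyDataO` (+ `_H`),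
  **`nonempty_iwasawaCohomologyDataO`** (`i ≤ 2`), **`iwasawaCohomologyDataOExists`** (`i = 0, 1, 2`).
What remains for `Nonempty (TwistedIwasawaDataO …)`: the unit half — Artin coordinates (A1) and Kato's norm-compatible
elliptic units read through `t_p(χ) ⊗` Kummer theory (Z1)/(Z2) — the `𝒪`-analogue of route C's
`…TwistedKatoKummer*` / `…TwistedIwasawaDataExist` files.

## References
* [JohnsonLeungKings2011] J. reine angew. Math. 653 (2011) = arXiv:0804.2828, §4.1 Def. 4.1 (p0012:L59–60), §4.2 Def. 4.2
  (94) and the `Λ_𝒪`-module structure (p0012:L80–112); Cor. 5.3 (p0015:L1–20).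
* [Kato2004Asterisque] K. Kato, Astérisque 295 (2004), §8.2 (p. 180), §12.2 (12.2.1) (p. 220).
* [Lang1990] S. Lang, *Cyclotomic Fields I and II*, Ch. 5 §1 (Thm. 1.1).
* [NeukirchSchmidtWingberg2008] I §5 Prop. 1.5.2–1.5.4 (cor natural, commutes with conjugation).
-/

noncomputable section

open scoped NumberField TensorProduct PowerSeries
open CategoryTheory Field IsDedekindDomain
open Literature.NumberTheory.GaloisRepresentations
open Literature.NumberTheory.GaloisRepresentations.DiscreteGaloisModule
open Literature.NumberTheory.EllipticCurves Literature.NumberTheory.EllipticCurves.IwasawaDual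
open Literature.Algebra.Module.LocallyNilpotent

namespace Literature.NumberTheory.ComplexMultiplication.EllipticUnits.JohnsonLeungKings2011

/-! ## §1 The corestrictions: equivariance for conjugation and `𝒪`-linearity -/

section Cores

variable {K : Type} [Field K] [NumberField K] {p : ℕ} [Fact p.Prime] (S : Set (PadicAlgCl p))
  (P : Set (HeightOneSpectrum (𝓞 K))) (θ : absoluteGaloisGroup K →ₜ* (padicCoeffIntegers S)ˣ)

/-- **The coefficient map as a morphism of the AMBIENT `G_S`-module** `(𝒪 ⊗ μ_{p^k} ⊗ θ)^{N_S} → (𝒪 ⊗ μ_{p^{k'}} ⊗ θ)^{N_S}`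
(the companion file's `levelMapHomO U` is its restriction to `U_S`). [cite: JohnsonLeungKings2011, Def. 4.2 (arXiv p0012:L80–95; plumbing)] -/
def coeffMapHomO {k k' : ℕ} (f : OMuCarrier K S (p ^ k) →+ OMuCarrier K S (p ^ k'))
    (hf : ∀ (σ : absoluteGaloisGroup K) (x : OMuCarrier K S (p ^ k)), f (muTwistO S θ k σ x) = muTwistO S θ k' σ (f x)) :
    (coeffGSO S P θ k).toTopRep ⟶ (coeffGSO S P θ k').toTopRep :=
  TopRep.ofHom ⟨⟨coeffMapO S P θ f hf, continuous_of_discreteTopology⟩, fun g ↦ by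
    ext w
    obtain ⟨σ, rfl⟩ := QuotientGroup.mk_surjective g
    exact congrArg Subtype.val
      (Subtype.ext (hf σ (w : OMuCarrier K S (p ^ k))) :
        coeffMapO S P θ f hf ((coeffGSO S P θ k) (QuotientGroup.mk σ) w) =
          (coeffGSO S P θ k') (QuotientGroup.mk σ) (coeffMapO S P θ f hf w))⟩

omit [NumberField K] in
/-- The level maps `H^i(f)` of the companion file are the tree's `cohomologyMap` of the restricted ambient
coefficient morphism (definitional bookkeeping). [cite: JohnsonLeungKings2011, Def. 4.2 (arXiv p0012:L80–95; plumbing)] -/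
theorem map_levelMapHomO_eq_cohomologyMap (U : Subgroup (absoluteGaloisGroup K)) {k k' : ℕ} (i : ℕ)
    (f : OMuCarrier K S (p ^ k) →+ OMuCarrier K S (p ^ k'))
    (hf : ∀ (σ : absoluteGaloisGroup K) (x : OMuCarrier K S (p ^ k)), f (muTwistO S θ k σ x) = muTwistO S θ k' σ (f x))
    (y : levelCohO S P θ U k i) :
    (ContinuousCohomology.map (ContinuousMonoidHom.id _) (levelMapHomO S P θ U f hf) i).hom y =
      cohomologyMap (resModHom (imGS P U) (coeffMapHomO S P θ f hf)) i y := rfl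

end Cores

section LayerCores

variable {K : Type} [Field K] [NumberField K] {p : ℕ} [Fact p.Prime] (S : Set (PadicAlgCl p))
  (κ₁ κ₂ : ZpExtension K p) (γ₁ γ₂ : absoluteGaloisGroup K)
  (θ : absoluteGaloisGroup K →ₜ* (padicCoeffIntegers S)ˣ) (𝔣 : Ideal (𝓞 K))

/-- **The corestrictions intertwine the conjugation operators**: `cor_{K̃_{n+1}/K̃_n} ∘ (γ ·) = (γ ·) ∘ cor` (the tree's
`relCor_conjMap`). [cite: NeukirchSchmidtWingberg2008, I §5 Prop. 1.5.4] -/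
theorem layerCoresO_layerConjO (n k i : ℕ) (γ : absoluteGaloisGroup K) (y : layerCohO S κ₁ κ₂ θ 𝔣 (n + 1) k i) :
    layerCoresO S κ₁ κ₂ θ 𝔣 n k i (layerConjO S κ₁ κ₂ θ 𝔣 (n + 1) k i γ y) =
      layerConjO S κ₁ κ₂ θ 𝔣 n k i γ (layerCoresO S κ₁ κ₂ θ 𝔣 n k i y) := by
  haveI : TotallyDisconnectedSpace (GaloisGroupUnramifiedOutside K (suppPF p 𝔣)) :=
    Literature.GroupTheory.ProfiniteSubquotients.totallyDisconnectedSpace_quotient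
      (ramificationSubgroup K (suppPF p 𝔣)) (ramificationSubgroup_isClosed K _)
  haveI := normal_imGS (suppPF p 𝔣) (pairLayerSubgroup κ₁ κ₂ n)
  haveI := normal_imGS (suppPF p 𝔣) (pairLayerSubgroup κ₁ κ₂ (n + 1))
  haveI : IsClosed (imGS (suppPF p 𝔣) (pairLayerSubgroup κ₁ κ₂ n) : Set (GaloisGroupUnramifiedOutside K (suppPF p 𝔣))) :=
    isClosed_imGS' _ (isOpen_pairLayerSubgroup κ₁ κ₂ n)
  haveI : IsClosed (imGS (suppPF p 𝔣) (pairLayerSubgroup κ₁ κ₂ (n + 1)) : Set (GaloisGroupUnramifiedOutside K (suppPF p 𝔣))) :=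
    isClosed_imGS' _ (isOpen_pairLayerSubgroup κ₁ κ₂ (n + 1))
  haveI : ((imGS (suppPF p 𝔣) (pairLayerSubgroup κ₁ κ₂ (n + 1))).subgroupOf
      (imGS (suppPF p 𝔣) (pairLayerSubgroup κ₁ κ₂ n))).FiniteIndex := by
    haveI := finiteIndex_imGS' (suppPF p 𝔣) (isOpen_pairLayerSubgroup κ₁ κ₂ (n + 1))
    infer_instance
  letI : Fintype (↥(imGS (suppPF p 𝔣) (pairLayerSubgroup κ₁ κ₂ n)) ⧸
      (imGS (suppPF p 𝔣) (pairLayerSubgroup κ₁ κ₂ (n + 1))).subgroupOf (imGS (suppPF p 𝔣) (pairLayerSubgroup κ₁ κ₂ n))) :=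
    Fintype.ofFinite _
  exact relCor_conjMap (imGS (suppPF p 𝔣) (pairLayerSubgroup κ₁ κ₂ n)) (imGS (suppPF p 𝔣) (pairLayerSubgroup κ₁ κ₂ (n + 1)))
    (coeffGSO S (suppPF p 𝔣) θ k) (toUnramifiedQuot K (suppPF p 𝔣) γ)
    (Subgroup.map_mono (pairLayerSubgroup_antitone κ₁ κ₂ (Nat.le_succ n))) i y

/-- **The corestrictions are natural in the coefficient maps** (`relCor_cohomologyMap`, every degree): for the
coefficient multiplication, `cor ∘ H^i(c ⊗ id) = H^i(c ⊗ id) ∘ cor` — the corestrictions are `𝒪`-LINEAR.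
[cite: NeukirchSchmidtWingberg2008, I §5 Prop. 1.5.2] [cite: JohnsonLeungKings2011, §4.1 Def. 4.1 (arXiv p0012:L59–60)] -/
theorem layerCoresO_layerScalarO (n k i : ℕ) (c : padicCoeffIntegers S) (y : layerCohO S κ₁ κ₂ θ 𝔣 (n + 1) k i) :
    layerCoresO S κ₁ κ₂ θ 𝔣 n k i (layerScalarO S κ₁ κ₂ θ 𝔣 (n + 1) k i c y) =
      layerScalarO S κ₁ κ₂ θ 𝔣 n k i c (layerCoresO S κ₁ κ₂ θ 𝔣 n k i y) := by
  haveI : TotallyDisconnectedSpace (GaloisGroupUnramifiedOutside K (suppPF p 𝔣)) :=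
    Literature.GroupTheory.ProfiniteSubquotients.totallyDisconnectedSpace_quotient
      (ramificationSubgroup K (suppPF p 𝔣)) (ramificationSubgroup_isClosed K _)
  haveI : IsClosed (imGS (suppPF p 𝔣) (pairLayerSubgroup κ₁ κ₂ n) : Set (GaloisGroupUnramifiedOutside K (suppPF p 𝔣))) :=
    isClosed_imGS' _ (isOpen_pairLayerSubgroup κ₁ κ₂ n)
  haveI : IsClosed (imGS (suppPF p 𝔣) (pairLayerSubgroup κ₁ κ₂ (n + 1)) : Set (GaloisGroupUnramifiedOutside K (suppPF p 𝔣))) :=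
    isClosed_imGS' _ (isOpen_pairLayerSubgroup κ₁ κ₂ (n + 1))
  haveI : ((imGS (suppPF p 𝔣) (pairLayerSubgroup κ₁ κ₂ (n + 1))).subgroupOf
      (imGS (suppPF p 𝔣) (pairLayerSubgroup κ₁ κ₂ n))).FiniteIndex := by
    haveI := finiteIndex_imGS' (suppPF p 𝔣) (isOpen_pairLayerSubgroup κ₁ κ₂ (n + 1))
    infer_instance
  letI : Fintype (↥(imGS (suppPF p 𝔣) (pairLayerSubgroup κ₁ κ₂ n)) ⧸
      (imGS (suppPF p 𝔣) (pairLayerSubgroup κ₁ κ₂ (n + 1))).subgroupOf (imGS (suppPF p 𝔣) (pairLayerSubgroup κ₁ κ₂ n))) :=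
    Fintype.ofFinite _
  exact relCor_cohomologyMap (imGS (suppPF p 𝔣) (pairLayerSubgroup κ₁ κ₂ n)) (imGS (suppPF p 𝔣) (pairLayerSubgroup κ₁ κ₂ (n + 1)))
    (coeffGSO S (suppPF p 𝔣) θ k) (coeffGSO S (suppPF p 𝔣) θ k)
    (coeffMapHomO S (suppPF p 𝔣) θ (oMuScalar S (p ^ k) c) (oMuScalar_muTwistO S θ k c))
    (Subgroup.map_mono (pairLayerSubgroup_antitone κ₁ κ₂ (Nat.le_succ n))) i y

end LayerCores

/-! ## §2 The `Λ_𝒪 = 𝒪⟦T₂⟧⟦T₁⟧`-module structure of the layer groups (`T_i ↦ conj_{γ_i} − 1`, `c ↦ H^i(c ⊗ id)`) -/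

section Construction

variable {K : Type} [Field K] [NumberField K] {p : ℕ} [Fact p.Prime] (S : Set (PadicAlgCl p))
  (κ₁ κ₂ : ZpExtension K p) (γ₁ γ₂ : absoluteGaloisGroup K)
  (θ : absoluteGaloisGroup K →ₜ* (padicCoeffIntegers S)ˣ) (𝔣 : Ideal (𝓞 K)) {i : ℕ} (hi : i ≤ 2)

include γ₁ γ₂ hi

/-- **Existence of the `Λ_𝒪`-structure on the layer group `H^i(G_S(K̃_n), 𝒪 ⊗ μ_{p^k} ⊗ θ)`** (`i ≤ 2`): an
intermediate `𝒪⟦T₂⟧`-structure (`X ↦ ψ_{γ₂}`, constants `C a ↦ H^i(a ⊗ id)`) and the nested `𝒪⟦T₂⟧⟦T₁⟧`-structure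
(`X ↦ ψ_{γ₁}`, `C f ↦ f`) — `LocallyNilpotent.exists_module_powerSeries₂` on the commuting locally nilpotent `𝒪`-linear
operators `ψ_{γ_i} = conj_{γ_i} − 1`. [cite: JohnsonLeungKings2011, §4.2 (arXiv p0012:L109–112)] [cite: Lang1990, Ch. 5 §1] -/
theorem exists_layerModuleO (n k : ℕ) :
    letI := levelModuleO S (suppPF p 𝔣) θ (pairLayerSubgroup κ₁ κ₂ n) k i
    ∃ (_ : Module (PowerSeries (padicCoeffIntegers S)) (layerCohO S κ₁ κ₂ θ 𝔣 n k i))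
      (_ : Module (IwasawaAlgebraO₂ S) (layerCohO S κ₁ κ₂ θ 𝔣 n k i)),
      (∀ (a : padicCoeffIntegers S) (v : layerCohO S κ₁ κ₂ θ 𝔣 n k i),
          (PowerSeries.C a : PowerSeries (padicCoeffIntegers S)) • v = a • v) ∧
        (∀ (f : PowerSeries (padicCoeffIntegers S)) (v : layerCohO S κ₁ κ₂ θ 𝔣 n k i),
            (PowerSeries.C f : IwasawaAlgebraO₂ S) • v = f • v) ∧
          (∀ v : layerCohO S κ₁ κ₂ θ 𝔣 n k i,
              (PowerSeries.X : PowerSeries (padicCoeffIntegers S)) • v = layerPsiO S κ₁ κ₂ θ 𝔣 n k i γ₂ v) ∧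
            ∀ v : layerCohO S κ₁ κ₂ θ 𝔣 n k i,
              (PowerSeries.X : IwasawaAlgebraO₂ S) • v = layerPsiO S κ₁ κ₂ θ 𝔣 n k i γ₁ v := by
  letI := levelModuleO S (suppPF p 𝔣) θ (pairLayerSubgroup κ₁ κ₂ n) k i
  obtain ⟨hcomm, h₁, h₂⟩ := layerPsiO_comm_and_locallyNilpotent S κ₁ κ₂ γ₁ γ₂ θ 𝔣 n k hi
  exact exists_module_powerSeries₂ (layerPsiO S κ₁ κ₂ θ 𝔣 n k i γ₁) (layerPsiO S κ₁ κ₂ θ 𝔣 n k i γ₂) hcomm h₁ h₂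

/-- **The intermediate `𝒪⟦T₂⟧`-structure of the layer group** (a choice; activate with `letI`).
[cite: JohnsonLeungKings2011, §4.2 (arXiv p0012:L109–112)] [cite: Lang1990, Ch. 5 §1] -/
@[reducible] def layerModuleO₁ (n k : ℕ) : Module (PowerSeries (padicCoeffIntegers S)) (layerCohO S κ₁ κ₂ θ 𝔣 n k i) :=
  (exists_layerModuleO S κ₁ κ₂ γ₁ γ₂ θ 𝔣 hi n k).choose

/-- **The `Λ_𝒪 = 𝒪⟦T₂⟧⟦T₁⟧`-structure of the layer group `H^i(G_S(K̃_n), 𝒪 ⊗ μ_{p^k} ⊗ θ)`** (`i ≤ 2`; a choice of the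
structure of `exists_layerModuleO`, whose ACTION is forced: `LocallyNilpotent.smul_eq_aeval_trunc_apply`; activate with
`letI`). [cite: JohnsonLeungKings2011, §4.2 (arXiv p0012:L109–112)] [cite: Lang1990, Ch. 5 §1] -/
@[reducible] def layerModuleO₂ (n k : ℕ) : Module (IwasawaAlgebraO₂ S) (layerCohO S κ₁ κ₂ θ 𝔣 n k i) :=
  (exists_layerModuleO S κ₁ κ₂ γ₁ γ₂ θ 𝔣 hi n k).choose_spec.choose

/-- The defining identities of the chosen structures: `C a ↦ H^i(a ⊗ id)`, `C f ↦ f`, `T₂ ↦ ψ_{γ₂}`, `T₁ ↦ ψ_{γ₁}`.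
[cite: JohnsonLeungKings2011, §4.2 (arXiv p0012:L109–112)] [cite: Lang1990, Ch. 5 §1] -/
theorem layerModuleO_spec (n k : ℕ) :
    letI := levelModuleO S (suppPF p 𝔣) θ (pairLayerSubgroup κ₁ κ₂ n) k i
    letI := layerModuleO₁ S κ₁ κ₂ γ₁ γ₂ θ 𝔣 hi n k
    letI := layerModuleO₂ S κ₁ κ₂ γ₁ γ₂ θ 𝔣 hi n k
    (∀ (a : padicCoeffIntegers S) (v : layerCohO S κ₁ κ₂ θ 𝔣 n k i),
        (PowerSeries.C a : PowerSeries (padicCoeffIntegers S)) • v = a • v) ∧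
      (∀ (f : PowerSeries (padicCoeffIntegers S)) (v : layerCohO S κ₁ κ₂ θ 𝔣 n k i),
          (PowerSeries.C f : IwasawaAlgebraO₂ S) • v = f • v) ∧
        (∀ v : layerCohO S κ₁ κ₂ θ 𝔣 n k i,
            (PowerSeries.X : PowerSeries (padicCoeffIntegers S)) • v = layerPsiO S κ₁ κ₂ θ 𝔣 n k i γ₂ v) ∧
          ∀ v : layerCohO S κ₁ κ₂ θ 𝔣 n k i,
            (PowerSeries.X : IwasawaAlgebraO₂ S) • v = layerPsiO S κ₁ κ₂ θ 𝔣 n k i γ₁ v :=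
  (exists_layerModuleO S κ₁ κ₂ γ₁ γ₂ θ 𝔣 hi n k).choose_spec.choose_spec

/-- **The corestrictions are `Λ_𝒪`-linear** (`LocallyNilpotent.map_smul₂_of_comp_eq`: they are `𝒪`-linear and
intertwine `ψ_{γ₁}, ψ_{γ₂}`). [cite: NeukirchSchmidtWingberg2008, I §5 Prop. 1.5.2–1.5.4] [cite: Lang1990, Ch. 5 §1] -/
theorem layerCoresO_smul (n k : ℕ) (F : IwasawaAlgebraO₂ S) (y : layerCohO S κ₁ κ₂ θ 𝔣 (n + 1) k i) :
    layerCoresO S κ₁ κ₂ θ 𝔣 n k i (letI := layerModuleO₂ S κ₁ κ₂ γ₁ γ₂ θ 𝔣 hi (n + 1) k; F • y) =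
      (letI := layerModuleO₂ S κ₁ κ₂ γ₁ γ₂ θ 𝔣 hi n k; F • layerCoresO S κ₁ κ₂ θ 𝔣 n k i y) := by
  letI i0 := levelModuleO S (suppPF p 𝔣) θ (pairLayerSubgroup κ₁ κ₂ (n + 1)) k i
  letI i1 := layerModuleO₁ S κ₁ κ₂ γ₁ γ₂ θ 𝔣 hi (n + 1) k
  letI i2 := layerModuleO₂ S κ₁ κ₂ γ₁ γ₂ θ 𝔣 hi (n + 1) k
  letI j0 := levelModuleO S (suppPF p 𝔣) θ (pairLayerSubgroup κ₁ κ₂ n) k i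
  letI j1 := layerModuleO₁ S κ₁ κ₂ γ₁ γ₂ θ 𝔣 hi n k
  letI j2 := layerModuleO₂ S κ₁ κ₂ γ₁ γ₂ θ 𝔣 hi n k
  obtain ⟨hC₀, hC, hX₂, hX₁⟩ := layerModuleO_spec S κ₁ κ₂ γ₁ γ₂ θ 𝔣 hi (n + 1) k
  obtain ⟨hC₀', hC', hX₂', hX₁'⟩ := layerModuleO_spec S κ₁ κ₂ γ₁ γ₂ θ 𝔣 hi n k
  obtain ⟨-, h₁, h₂⟩ := layerPsiO_comm_and_locallyNilpotent S κ₁ κ₂ γ₁ γ₂ θ 𝔣 (n + 1) k hi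
  let f : layerCohO S κ₁ κ₂ θ 𝔣 (n + 1) k i →ₗ[padicCoeffIntegers S] layerCohO S κ₁ κ₂ θ 𝔣 n k i :=
    { toFun := layerCoresO S κ₁ κ₂ θ 𝔣 n k i
      map_add' := map_add _
      map_smul' := fun c y ↦ layerCoresO_layerScalarO S κ₁ κ₂ θ 𝔣 n k i c y }
  exact map_smul₂_of_comp_eq hC₀ hC hX₂ hX₁ hC₀' hC' hX₂' hX₁' h₁ h₂ f
    (fun y ↦ by
      change layerCoresO S κ₁ κ₂ θ 𝔣 n k i (layerConjO S κ₁ κ₂ θ 𝔣 (n + 1) k i γ₁ y - y) =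
        layerConjO S κ₁ κ₂ θ 𝔣 n k i γ₁ (layerCoresO S κ₁ κ₂ θ 𝔣 n k i y) - layerCoresO S κ₁ κ₂ θ 𝔣 n k i y
      rw [map_sub, layerCoresO_layerConjO])
    (fun y ↦ by
      change layerCoresO S κ₁ κ₂ θ 𝔣 n k i (layerConjO S κ₁ κ₂ θ 𝔣 (n + 1) k i γ₂ y - y) =
        layerConjO S κ₁ κ₂ θ 𝔣 n k i γ₂ (layerCoresO S κ₁ κ₂ θ 𝔣 n k i y) - layerCoresO S κ₁ κ₂ θ 𝔣 n k i y
      rw [map_sub, layerCoresO_layerConjO]) F y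

/-- **The reductions are `Λ_𝒪`-linear.** [cite: Kato2004Asterisque, §8.2 (p. 180)] [cite: Lang1990, Ch. 5 §1] -/
theorem layerRedO_smul (n k : ℕ) (F : IwasawaAlgebraO₂ S) (y : layerCohO S κ₁ κ₂ θ 𝔣 n (k + 1) i) :
    layerRedO S κ₁ κ₂ θ 𝔣 n k i (letI := layerModuleO₂ S κ₁ κ₂ γ₁ γ₂ θ 𝔣 hi n (k + 1); F • y) =
      (letI := layerModuleO₂ S κ₁ κ₂ γ₁ γ₂ θ 𝔣 hi n k; F • layerRedO S κ₁ κ₂ θ 𝔣 n k i y) := by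
  letI i0 := levelModuleO S (suppPF p 𝔣) θ (pairLayerSubgroup κ₁ κ₂ n) (k + 1) i
  letI i1 := layerModuleO₁ S κ₁ κ₂ γ₁ γ₂ θ 𝔣 hi n (k + 1)
  letI i2 := layerModuleO₂ S κ₁ κ₂ γ₁ γ₂ θ 𝔣 hi n (k + 1)
  letI j0 := levelModuleO S (suppPF p 𝔣) θ (pairLayerSubgroup κ₁ κ₂ n) k i
  letI j1 := layerModuleO₁ S κ₁ κ₂ γ₁ γ₂ θ 𝔣 hi n k
  letI j2 := layerModuleO₂ S κ₁ κ₂ γ₁ γ₂ θ 𝔣 hi n k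
  obtain ⟨hC₀, hC, hX₂, hX₁⟩ := layerModuleO_spec S κ₁ κ₂ γ₁ γ₂ θ 𝔣 hi n (k + 1)
  obtain ⟨hC₀', hC', hX₂', hX₁'⟩ := layerModuleO_spec S κ₁ κ₂ γ₁ γ₂ θ 𝔣 hi n k
  obtain ⟨-, h₁, h₂⟩ := layerPsiO_comm_and_locallyNilpotent S κ₁ κ₂ γ₁ γ₂ θ 𝔣 n (k + 1) hi
  let f : layerCohO S κ₁ κ₂ θ 𝔣 n (k + 1) i →ₗ[padicCoeffIntegers S] layerCohO S κ₁ κ₂ θ 𝔣 n k i :=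
    { toFun := layerRedO S κ₁ κ₂ θ 𝔣 n k i
      map_add' := map_add _
      map_smul' := fun c y ↦ layerRedO_layerScalarO S κ₁ κ₂ θ 𝔣 n k i c y }
  exact map_smul₂_of_comp_eq hC₀ hC hX₂ hX₁ hC₀' hC' hX₂' hX₁' h₁ h₂ f
    (fun y ↦ by
      change layerRedO S κ₁ κ₂ θ 𝔣 n k i (layerConjO S κ₁ κ₂ θ 𝔣 n (k + 1) i γ₁ y - y) =
        layerConjO S κ₁ κ₂ θ 𝔣 n k i γ₁ (layerRedO S κ₁ κ₂ θ 𝔣 n k i y) - layerRedO S κ₁ κ₂ θ 𝔣 n k i y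
      rw [map_sub, layerRedO_layerConjO])
    (fun y ↦ by
      change layerRedO S κ₁ κ₂ θ 𝔣 n k i (layerConjO S κ₁ κ₂ θ 𝔣 n (k + 1) i γ₂ y - y) =
        layerConjO S κ₁ κ₂ θ 𝔣 n k i γ₂ (layerRedO S κ₁ κ₂ θ 𝔣 n k i y) - layerRedO S κ₁ κ₂ θ 𝔣 n k i y
      rw [map_sub, layerRedO_layerConjO]) F y

/-! ## §3 The `Λ_𝒪`-submodule of compatible families and the datum -/

/-- The product `Λ_𝒪`-module `∏_{n,k} H^i(G_S(K̃_n), 𝒪 ⊗ μ_{p^k} ⊗ θ)` (activate with `letI`).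
[cite: JohnsonLeungKings2011, Def. 4.2 (94) (arXiv p0012:L94)] -/
@[reducible] def piLayerModuleO : Module (IwasawaAlgebraO₂ S) (∀ n k : ℕ, layerCohO S κ₁ κ₂ θ 𝔣 n k i) := by
  letI : ∀ n k : ℕ, Module (IwasawaAlgebraO₂ S) (layerCohO S κ₁ κ₂ θ 𝔣 n k i) :=
    fun n k ↦ layerModuleO₂ S κ₁ κ₂ γ₁ γ₂ θ 𝔣 hi n k
  infer_instance

/-- The product action is componentwise. [cite: JohnsonLeungKings2011, Def. 4.2 (94) (arXiv p0012:L94)] -/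
theorem piLayerModuleO_smul_apply (F : IwasawaAlgebraO₂ S) (y : ∀ n k : ℕ, layerCohO S κ₁ κ₂ θ 𝔣 n k i) (n k : ℕ) :
    (letI := piLayerModuleO S κ₁ κ₂ γ₁ γ₂ θ 𝔣 hi; F • y) n k =
      (letI := layerModuleO₂ S κ₁ κ₂ γ₁ γ₂ θ 𝔣 hi n k; F • y n k) := rfl

/-- **`H^i(𝒪_K[1/p𝔣], Λ_𝒪(χ)(1)) := lim←_{n,k} H^i(G_S(K̃_n), 𝒪 ⊗ μ_{p^k} ⊗ θ)` as a `Λ_𝒪`-SUBMODULE of the product**: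
the compatible families (`IsCompatibleFamilyO`), stable under `Λ_𝒪` because the corestrictions and the reductions are
`Λ_𝒪`-linear (`layerCoresO_smul`, `layerRedO_smul`). [cite: JohnsonLeungKings2011, Def. 4.2 (94) (arXiv p0012:L94)] [cite: Kato2004Asterisque, §8.2 (p. 180)] -/
def compatibleFamiliesO :
    letI := piLayerModuleO S κ₁ κ₂ γ₁ γ₂ θ 𝔣 hi
    Submodule (IwasawaAlgebraO₂ S) (∀ n k : ℕ, layerCohO S κ₁ κ₂ θ 𝔣 n k i) := by
  letI := piLayerModuleO S κ₁ κ₂ γ₁ γ₂ θ 𝔣 hi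
  exact
    { carrier := {y | IsCompatibleFamilyO S κ₁ κ₂ θ 𝔣 i y}
      zero_mem' := ⟨fun n k ↦ by simp only [Pi.zero_apply, map_zero], fun n k ↦ by simp only [Pi.zero_apply, map_zero]⟩
      add_mem' := fun {y y'} hy hy' ↦
        ⟨fun n k ↦ by simp only [Pi.add_apply, map_add, hy.1 n k, hy'.1 n k],
          fun n k ↦ by simp only [Pi.add_apply, map_add, hy.2 n k, hy'.2 n k]⟩
      smul_mem' := fun F y hy ↦
        ⟨fun n k ↦ by rw [piLayerModuleO_smul_apply, piLayerModuleO_smul_apply, layerCoresO_smul, hy.1 n k],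
          fun n k ↦ by rw [piLayerModuleO_smul_apply, piLayerModuleO_smul_apply, layerRedO_smul, hy.2 n k]⟩ }

/-- **The pinned datum `H^i(𝒪_K[1/p𝔣], Λ_𝒪(χ)(1))`, CONSTRUCTED** (`i ≤ 2`): carrier = the `Λ_𝒪`-submodule of compatible
families, `proj n k` = the coordinates; (P1)–(P4) by construction, (P5)–(P7) = the defining identities of the
`Λ_𝒪`-structure (`T₁ ↦ conj_{γ₁} − 1`, `C X ↦ conj_{γ₂} − 1`, `C (C c) ↦ H^i(c ⊗ id)`), (P8) because the action is
levelwise. [cite: JohnsonLeungKings2011, §4.1 Def. 4.1 and §4.2 Def. 4.2 (94) (arXiv p0012:L39–60, L80–112)] [cite: Kato2004Asterisque, §8.2 (p. 180), §12.2 (12.2.1) (p. 220)] -/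
def iwasawaCohomologyDataO : IwasawaCohomologyDataO S κ₁ κ₂ γ₁ γ₂ θ 𝔣 i :=
  letI := piLayerModuleO S κ₁ κ₂ γ₁ γ₂ θ 𝔣 hi
  { H := ↥(compatibleFamiliesO S κ₁ κ₂ γ₁ γ₂ θ 𝔣 hi)
    proj := fun n k ↦
      { toFun := fun y ↦ (y : ∀ n k : ℕ, layerCohO S κ₁ κ₂ θ 𝔣 n k i) n k
        map_zero' := rfl
        map_add' := fun _ _ ↦ rfl }
    proj_cores := fun n k y ↦ y.2.1 n k
    proj_red := fun n k y ↦ y.2.2 n k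
    proj_injective := fun y hy ↦ Subtype.ext (funext fun n ↦ funext fun k ↦ hy n k)
    proj_surjective := fun y hy ↦ ⟨⟨y, hy⟩, fun _ _ ↦ rfl⟩
    proj_T₁_smul := fun n k y ↦ by
      change (letI := layerModuleO₂ S κ₁ κ₂ γ₁ γ₂ θ 𝔣 hi n k;
        (PowerSeries.X : IwasawaAlgebraO₂ S) • (y : ∀ n k : ℕ, layerCohO S κ₁ κ₂ θ 𝔣 n k i) n k) = _
      rw [(layerModuleO_spec S κ₁ κ₂ γ₁ γ₂ θ 𝔣 hi n k).2.2.2, layerPsiO_apply]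
      rfl
    proj_T₂_smul := fun n k y ↦ by
      change (letI := layerModuleO₂ S κ₁ κ₂ γ₁ γ₂ θ 𝔣 hi n k;
        (PowerSeries.C (PowerSeries.X : PowerSeries (padicCoeffIntegers S)) : IwasawaAlgebraO₂ S) •
          (y : ∀ n k : ℕ, layerCohO S κ₁ κ₂ θ 𝔣 n k i) n k) = _
      letI := levelModuleO S (suppPF p 𝔣) θ (pairLayerSubgroup κ₁ κ₂ n) k i
      letI := layerModuleO₁ S κ₁ κ₂ γ₁ γ₂ θ 𝔣 hi n k
      letI := layerModuleO₂ S κ₁ κ₂ γ₁ γ₂ θ 𝔣 hi n k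
      rw [C_X_smul (layerModuleO_spec S κ₁ κ₂ γ₁ γ₂ θ 𝔣 hi n k).2.1 (layerModuleO_spec S κ₁ κ₂ γ₁ γ₂ θ 𝔣 hi n k).2.2.1,
        layerPsiO_apply]
      rfl
    proj_C_smul := fun c n k y ↦ by
      change (letI := layerModuleO₂ S κ₁ κ₂ γ₁ γ₂ θ 𝔣 hi n k;
        (PowerSeries.C (PowerSeries.C c : PowerSeries (padicCoeffIntegers S)) : IwasawaAlgebraO₂ S) •
          (y : ∀ n k : ℕ, layerCohO S κ₁ κ₂ θ 𝔣 n k i) n k) = _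
      letI := levelModuleO S (suppPF p 𝔣) θ (pairLayerSubgroup κ₁ κ₂ n) k i
      letI := layerModuleO₁ S κ₁ κ₂ γ₁ γ₂ θ 𝔣 hi n k
      letI := layerModuleO₂ S κ₁ κ₂ γ₁ γ₂ θ 𝔣 hi n k
      rw [C_C_smul (layerModuleO_spec S κ₁ κ₂ γ₁ γ₂ θ 𝔣 hi n k).1 (layerModuleO_spec S κ₁ κ₂ γ₁ γ₂ θ 𝔣 hi n k).2.1]
      rfl
    proj_smul_eq_zero := fun n k F y hy ↦ by
      letI := layerModuleO₂ S κ₁ κ₂ γ₁ γ₂ θ 𝔣 hi n k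
      change F • (y : ∀ n k : ℕ, layerCohO S κ₁ κ₂ θ 𝔣 n k i) n k = 0
      have hy' : (y : ∀ n k : ℕ, layerCohO S κ₁ κ₂ θ 𝔣 n k i) n k = 0 := hy
      rw [hy', smul_zero] }

/-- The carrier of the constructed datum is the module of compatible families (unfolding).
[cite: JohnsonLeungKings2011, Def. 4.2 (94) (arXiv p0012:L94)] -/
theorem iwasawaCohomologyDataO_H :
    (iwasawaCohomologyDataO S κ₁ κ₂ γ₁ γ₂ θ 𝔣 hi).H = compatibleFamiliesO S κ₁ κ₂ γ₁ γ₂ θ 𝔣 hi := rfl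

/-- **EXISTENCE: `Nonempty (IwasawaCohomologyDataO S κ₁ κ₂ γ₁ γ₂ θ 𝔣 i)` for `i ≤ 2`** — for EVERY number field `K`,
prime `p`, coefficient set `S ⊆ ℚ̄_p`, pair of `ℤ_p`-extensions `(κ₁, κ₂)`, pair of group elements `(γ₁, γ₂)`, character
`θ : Γ_K → 𝒪ˣ` and modulus `𝔣`: the pinned `𝒪`-coefficient carriers of `cor53_thm52ShapeO` exist (the genuine Iwasawa
cohomology with its conjugation-and-coefficient `Λ_𝒪`-structure).
[cite: JohnsonLeungKings2011, §4.2 Def. 4.2 (94) (arXiv p0012:L80–112) and Cor. 5.3 (p0015:L1–20)] [cite: Kato2004Asterisque, §8.2 (p. 180)] -/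
theorem nonempty_iwasawaCohomologyDataO : Nonempty (IwasawaCohomologyDataO S κ₁ κ₂ γ₁ γ₂ θ 𝔣 i) :=
  ⟨iwasawaCohomologyDataO S κ₁ κ₂ γ₁ γ₂ θ 𝔣 hi⟩

end Construction

/-- **The three pinned `𝒪`-coefficient carriers of [JLK] Cor. 5.3 EXIST**: `H⁰, H¹, H²(𝒪_K[1/p𝔣], Λ_𝒪(χ)(1))` with their
`Λ_𝒪`-structure, for every `(K, p, S, κ₁, κ₂, γ₁, γ₂, θ, 𝔣)` — the cohomological half of the existence of
`TwistedIwasawaDataO` (the unit part (A1)/(Z1)/(Z2) — Artin coordinates and Kato's norm-compatible elliptic units read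
through `t_p(χ) ⊗` Kummer theory — is the remaining construction).
[cite: JohnsonLeungKings2011, §4.2 Def. 4.2 (94) (arXiv p0012:L80–112) and Cor. 5.3 (p0015:L1–20)] -/
theorem iwasawaCohomologyDataOExists {K : Type} [Field K] [NumberField K] {p : ℕ} [Fact p.Prime]
    (S : Set (PadicAlgCl p)) (κ₁ κ₂ : ZpExtension K p) (γ₁ γ₂ : absoluteGaloisGroup K)
    (θ : absoluteGaloisGroup K →ₜ* (padicCoeffIntegers S)ˣ) (𝔣 : Ideal (𝓞 K)) :
    Nonempty (IwasawaCohomologyDataO S κ₁ κ₂ γ₁ γ₂ θ 𝔣 0) ∧ Nonempty (IwasawaCohomologyDataO S κ₁ κ₂ γ₁ γ₂ θ 𝔣 1) ∧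
      Nonempty (IwasawaCohomologyDataO S κ₁ κ₂ γ₁ γ₂ θ 𝔣 2) :=
  ⟨nonempty_iwasawaCohomologyDataO S κ₁ κ₂ γ₁ γ₂ θ 𝔣 (by omega),
    nonempty_iwasawaCohomologyDataO S κ₁ κ₂ γ₁ γ₂ θ 𝔣 (by omega),
    nonempty_iwasawaCohomologyDataO S κ₁ κ₂ γ₁ γ₂ θ 𝔣 le_rfl⟩

end Literature.NumberTheory.ComplexMultiplication.EllipticUnits.JohnsonLeungKings2011

end
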